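import Summits.BirchSwinnertonDyer.BirchSwinnertonDyer.Theorems.ByReductionTypeAtTwoOrdKatoHalfAtTwoIsoConjATwoOfTotallyComplexMuRat
import Summits.BirchSwinnertonDyer.BirchSwinnertonDyer.Theorems.AlignedTransportAtTwoMainConjectureOfRankZeroBSDAtTwoFineRoadDivisionCubic
import Literature.NumberTheory.IwasawaTheory.ClassicalMuVanishesQuadraticAscentSqrtOdd
import Literature.NumberTheory.NumberFields.CubicFieldOneRealPlace
import HarnessLib

/-!
# Statement (A) at `2` for `y² = x³ + px² + qx + r` over `ℚ` with NEGATIVE cubic discriminant from ANY `μ₂ = 0` certificate of the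
# cubic field `ℚ(β)` — crux `OrdKatoHalfAtTwoIso` (stmt-BirchSwinnertonDyer-19573), K4 cone, cell bsd-2adic

Written by the prover seat `cruxlead-stmt-BirchSwinnertonDyer-19573-w2` GEN 7 (`--supports` stmt-BirchSwinnertonDyer-19573; no item closed; BSD is NOT
proved here). Module (E-f), the consumable end of the seat's «Iwasawa ℓ = 2 ascent with real places»:

**`conjA_two_cubicModel_of_classicalMu_of_discr_neg`** — `p q r ∈ ℤ`, `X³ + pX² + qX + r` irreducible with discriminant `< 0`, `β ∈ ℚ̄` a
root; if `μ₂ = 0` for the cyclotomic `ℤ₂`-extensions of the cubic field `ℚ(β)` (ANY of the cell's certificates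
`classicalMuVanishes_two_adjoin_of_*`), then statement (A) at `2` holds for `y² = x³ + px² + qx + r` in the K4 cone's kernel form
(`∃ γ D, Module.Finite ℤ_[2] D.X` for every cyclotomic `κ`).

Assembly: `ℚ(E[2]) = ℚ(β, e₂, e₃) = ℚ(β)(e₂ − e₃)` with `(e₂ − e₃)² = −3β² − 2pβ + p² − 4q ∈ 𝓞_{ℚ(β)}` (Vieta); `[ℚ(β) : ℚ] = 3` is odd;
`ℚ(β)` has exactly one real place (`CubicFieldOneRealPlace`, discriminant `< 0`); `Δ_E = 16·disc < 0` makes `ℚ(E[2])` totally complex; then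
Literature `classicalMu_of_sq_eq_of_odd_finrank` (μ₂ ascent along `ℚ(E[2])/ℚ(β)`) and `conjA_two_of_classicalMu_divisionField_two_of_Δ_neg`.
Compared with the cell's GENUS DOOR (`conjA_two_cubicModel_of_genus`: odd `h`, ONE prime over `2`), this door accepts every `μ₂ = 0`
certificate of `ℚ(β)` (split `2`, even-index certificates, two-layer certificates, …).

References: [Iwasawa1973MuInvariants] Thm. 2/3; [CoatesSujatha2005] §3; [SilvermanAEC2009] III §1, VIII §1; [Cohen1993] §4.1.3.
-/

set_option autoImplicit false

noncomputable section

open scoped NumberField Polynomial IntermediateField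
open NumberField Field Polynomial IntermediateField

namespace Summit.BirchSwinnertonDyer.BirchSwinnertonDyer.Theorems.SteinbergFibreAtTwo.TotallyComplexMu

open Literature.NumberTheory.EllipticCurves Literature.NumberTheory.EllipticCurves.ZpExtension
  Literature.NumberTheory.GaloisRepresentations Literature.NumberTheory.IwasawaTheory Literature.NumberTheory.NumberFields
  Summit.BirchSwinnertonDyer.BirchSwinnertonDyer.Theorems.AlignedTransportAtTwoFineRoad.DivisionCubic

/-- A number field with at most one real place has at most one ring morphism to `ℝ`. [folklore] -/
private theorem subsingleton_ringHom_real {K : Type} [Field K] [NumberField K]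
    (h : Nat.card {w : InfinitePlace K // w.IsReal} ≤ 1) : Subsingleton (K →+* ℝ) := by
  have hsub : Subsingleton {w : InfinitePlace K // w.IsReal} := Finite.card_le_one_iff_subsingleton.mp h
  have hreal : ∀ ρ : K →+* ℝ, ComplexEmbedding.IsReal (Complex.ofRealHom.comp ρ) := fun ρ ↦ by
    rw [ComplexEmbedding.isReal_iff]; ext x; simp [ComplexEmbedding.conjugate_coe_eq]
  refine ⟨fun ρ₁ ρ₂ ↦ ?_⟩
  have h12 : InfinitePlace.mkReal ⟨_, hreal ρ₁⟩ = InfinitePlace.mkReal ⟨_, hreal ρ₂⟩ := Subsingleton.elim _ _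
  have h' := Subtype.ext_iff.mp (InfinitePlace.mkReal.injective h12)
  ext x
  have hx := RingHom.congr_fun h' x
  simpa using hx

/-- `(e₂ − e₃)² = −3β² − 2pβ + p² − 4q` for the roots `β, e₂, e₃` of `X³ + pX² + qX + r` (Vieta). [folklore] -/
private theorem sq_sub_eq_of_vieta {R : Type} [CommRing R] {β e₂ e₃ p q : R} (h1 : β + e₂ + e₃ = -p)
    (h2 : β * e₂ + β * e₃ + e₂ * e₃ = q) : (e₂ - e₃) ^ 2 = -3 * β ^ 2 - 2 * p * β + p ^ 2 - 4 * q := by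
  linear_combination (e₂ + e₃ + 3 * β - p) * h1 + (-4) * h2

/-- An element of `ℚ̄` integral over `ℤ` gives an integral element of any intermediate field containing it. [folklore] -/
private theorem isIntegral_mk {L : IntermediateField ℚ (AlgebraicClosure ℚ)} {y : AlgebraicClosure ℚ} (hy : y ∈ L)
    (hint : IsIntegral ℤ y) : IsIntegral ℤ (⟨y, hy⟩ : ↥L) :=
  (isIntegral_algHom_iff (IsScalarTower.toAlgHom ℤ ↥L (AlgebraicClosure ℚ)) Subtype.val_injective).mp hint

/-- **Statement (A) at `2` for `y² = x³ + px² + qx + r` (`p, q, r ∈ ℤ`, cubic irreducible with NEGATIVE discriminant) from ANY `μ₂ = 0`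
certificate of the cubic field `ℚ(β)`**: if `μ = 0` for the cyclotomic `ℤ₂`-extensions of `ℚ(β)` (`β ∈ ℚ̄` a root), then for every
cyclotomic `κ` some `FineSelmerDualData` of `⟨0, p, 0, q, r⟩` has `X` finitely generated over `ℤ₂` (the K4 cone's kernel form of (A) at `2`).
Route: `ℚ(E[2]) = ℚ(β)(e₂ − e₃)`, `(e₂ − e₃)² ∈ 𝓞_{ℚ(β)}`, `[ℚ(β) : ℚ] = 3`, one real place of `ℚ(β)`, `ℚ(E[2])` totally complex
(`Δ = 16·disc < 0`); μ₂ ascent (Literature `classicalMu_of_sq_eq_of_odd_finrank`) and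
`conjA_two_of_classicalMu_divisionField_two_of_Δ_neg`. BSD is not proved here. [cite: Iwasawa1973MuInvariants, Thm. 2 and Thm. 3]
[cite: CoatesSujatha2005, §3 Thm. 3.4 and Cor. 3.6] [cite: SilvermanAEC2009, VIII.§1 (K(E[m]))] -/
theorem conjA_two_cubicModel_of_classicalMu_of_discr_neg (p q r : ℤ)
    [((⟨0, (p : ℚ), 0, (q : ℚ), (r : ℚ)⟩ : WeierstrassCurve ℚ)).IsElliptic]
    (hirr : Irreducible (Cubic.toPoly ⟨1, (p : ℚ), q, r⟩)) (hd : Cubic.discr ⟨1, (p : ℚ), q, r⟩ < 0)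
    {β : AlgebraicClosure ℚ} (hβ : aeval β (Cubic.toPoly ⟨1, (p : ℚ), q, r⟩) = 0)
    (hμ : ∀ κP : ZpExtension ↥(IntermediateField.adjoin ℚ ({β} : Set (AlgebraicClosure ℚ))) 2,
      κP.IsCyclotomic → ClassicalMuVanishes κP)
    (κ : ZpExtension ℚ 2) (hκ : κ.IsCyclotomic) :
    ∃ (γ : absoluteGaloisGroup ℚ) (D : ((⟨0, (p : ℚ), 0, (q : ℚ), (r : ℚ)⟩ : WeierstrassCurve ℚ)).FineSelmerDualData κ γ),
      Module.Finite ℤ_[2] (RestrictScalars ℤ_[2] (IwasawaAlgebra 2) D.X) := by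
  haveI : Fact (Nat.Prime 2) := ⟨Nat.prime_two⟩
  set W : WeierstrassCurve ℚ := ⟨0, (p : ℚ), 0, (q : ℚ), (r : ℚ)⟩ with hW
  set K : IntermediateField ℚ (AlgebraicClosure ℚ) := IntermediateField.adjoin ℚ ({β} : Set (AlgebraicClosure ℚ)) with hKdef
  set K2 : IntermediateField ℚ (AlgebraicClosure ℚ) := W.divisionField 2 with hK2def
  set φ := algebraMap ℚ (AlgebraicClosure ℚ) with hφ
  -- §A the cubic field `K = ℚ(β)`
  have hmonic : (Cubic.toPoly ⟨1, (p : ℚ), q, r⟩).Monic := Cubic.monic_of_a_eq_one rfl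
  have hβint : IsIntegral ℚ β := ⟨_, hmonic, by rwa [← aeval_def]⟩
  haveI : FiniteDimensional ℚ ↥K := IntermediateField.adjoin.finiteDimensional hβint
  haveI : NumberField ↥K := NumberField.mk
  have h3 : Module.finrank ℚ ↥K = 3 := by
    rw [hKdef, IntermediateField.adjoin.finrank hβint, ← minpoly.eq_of_irreducible_of_monic hirr hβ hmonic]
    exact Cubic.natDegree_of_a_ne_zero' one_ne_zero
  have hodd : Odd (Module.finrank ℚ ↥K) := by rw [h3]; decide
  haveI : Subsingleton (↥K →+* ℝ) :=
    subsingleton_ringHom_real (le_of_eq (card_isReal_adjoin_eq_one_of_cubic_discr_neg (P := ⟨1, (p : ℚ), q, r⟩) rfl hd hβ h3))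
  -- §B `Δ = 16·disc < 0`: `ℚ(E[2])` is totally complex
  have hΔ : W.Δ < 0 := by
    have e : W.Δ = 16 * Cubic.discr ⟨1, (p : ℚ), q, r⟩ := by
      simp only [hW, WeierstrassCurve.Δ, WeierstrassCurve.b₂, WeierstrassCurve.b₄, WeierstrassCurve.b₆, WeierstrassCurve.b₈,
        Cubic.discr]
      ring
    rw [e]; linarith
  haveI : NumberField ↥K2 := NumberField.mk
  haveI : IsTotallyComplex ↥K2 := ⟨isComplex_infinitePlace_divisionField_two_of_Δ_neg W hΔ⟩
  -- §C the roots `β, e₂, e₃` and `ℚ(E[2]) = ℚ(β, e₂, e₃)`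
  set g : ℚ[X] := X ^ 3 + C (p : ℚ) * X ^ 2 + C (q : ℚ) * X + C (r : ℚ) with hg
  have hgP : g = Cubic.toPoly ⟨1, (p : ℚ), q, r⟩ := by simp only [hg, Cubic.toPoly, map_one, one_mul]
  have hK2eq : K2 = IntermediateField.adjoin ℚ (g.rootSet (AlgebraicClosure ℚ)) :=
    divisionField_two_eq_adjoin_rootSet_of_a₁_a₃_eq_zero (p : ℚ) q r
  obtain ⟨x, y, z, h3r⟩ := (Cubic.splits_iff_roots_eq_three (φ := φ) (P := ⟨1, (p : ℚ), q, r⟩) one_ne_zero).mp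
    (IsAlgClosed.splits _)
  have hg0 : g ≠ 0 := by rw [hgP]; exact hmonic.ne_zero
  have hroots : ∀ w, w ∈ g.rootSet (AlgebraicClosure ℚ) ↔ (w = x ∨ w = y ∨ w = z) := fun w ↦ by
    have e1 : w ∈ g.rootSet (AlgebraicClosure ℚ) ↔ w ∈ (Cubic.map φ ⟨1, (p : ℚ), q, r⟩).roots := by
      rw [Cubic.map_roots, ← hgP, mem_rootSet, mem_roots ((Polynomial.map_ne_zero_iff φ.injective).mpr hg0), IsRoot.def,
        eval_map, ← aeval_def]
      exact ⟨fun h ↦ h.2, fun h ↦ ⟨hg0, h⟩⟩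
    rw [e1, h3r]
    simp only [Multiset.insert_eq_cons, Multiset.mem_cons, Multiset.mem_singleton]
  have hβroot : β ∈ g.rootSet (AlgebraicClosure ℚ) := by
    rw [mem_rootSet, hgP]; exact ⟨hmonic.ne_zero, hβ⟩
  have hne := (Cubic.discr_ne_zero_iff_roots_ne one_ne_zero h3r).mp hd.ne
  have hb := Cubic.b_eq_three_roots (φ := φ) (P := ⟨1, (p : ℚ), q, r⟩) one_ne_zero h3r
  have hc := Cubic.c_eq_three_roots (φ := φ) (P := ⟨1, (p : ℚ), q, r⟩) one_ne_zero h3r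
  change φ (p : ℚ) = φ 1 * -(x + y + z) at hb
  change φ (q : ℚ) = φ 1 * (x * y + x * z + y * z) at hc
  rw [map_one, one_mul, hφ, map_intCast] at hb hc
  -- choose the two other roots
  obtain ⟨e₂, e₃, he₂, he₃, hne23, hsum, hprod, hall⟩ : ∃ e₂ e₃ : AlgebraicClosure ℚ,
      e₂ ∈ g.rootSet (AlgebraicClosure ℚ) ∧ e₃ ∈ g.rootSet (AlgebraicClosure ℚ) ∧ e₂ ≠ e₃ ∧
      β + e₂ + e₃ = -(p : AlgebraicClosure ℚ) ∧ β * e₂ + β * e₃ + e₂ * e₃ = (q : AlgebraicClosure ℚ) ∧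
      ∀ w ∈ g.rootSet (AlgebraicClosure ℚ), w = β ∨ w = e₂ ∨ w = e₃ := by
    rcases (hroots β).mp hβroot with rfl | rfl | rfl
    · exact ⟨y, z, (hroots y).mpr (Or.inr (Or.inl rfl)), (hroots z).mpr (Or.inr (Or.inr rfl)), hne.2.2,
        by linear_combination hb, by linear_combination -hc, fun w hw ↦ (hroots w).mp hw⟩
    · refine ⟨x, z, (hroots x).mpr (Or.inl rfl), (hroots z).mpr (Or.inr (Or.inr rfl)), hne.2.1,
        by linear_combination hb, by linear_combination -hc, fun w hw ↦ ?_⟩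
      rcases (hroots w).mp hw with h | h | h
      · exact Or.inr (Or.inl h)
      · exact Or.inl h
      · exact Or.inr (Or.inr h)
    · refine ⟨x, y, (hroots x).mpr (Or.inl rfl), (hroots y).mpr (Or.inr (Or.inl rfl)), hne.1,
        by linear_combination hb, by linear_combination -hc, fun w hw ↦ ?_⟩
      rcases (hroots w).mp hw with h | h | h
      · exact Or.inr (Or.inl h)
      · exact Or.inr (Or.inr h)
      · exact Or.inl h
  -- §D `K ≤ K2`, the integers `b = β ∈ 𝓞 K`, `x' = e₂ - e₃ ∈ 𝓞 K2`, `m = -3b² - 2pb + p² - 4q`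
  have hsubK2 : g.rootSet (AlgebraicClosure ℚ) ⊆ K2 := by
    rw [hK2eq]; exact IntermediateField.subset_adjoin ℚ _
  have hle : K ≤ K2 := by
    rw [hKdef]; exact IntermediateField.adjoin_le_iff.mpr (Set.singleton_subset_iff.mpr (hsubK2 hβroot))
  letI : Algebra ↥K ↥K2 := (IntermediateField.inclusion hle).toRingHom.toAlgebra
  haveI : IsScalarTower ℚ ↥K ↥K2 := IsScalarTower.of_algebraMap_eq fun _ ↦ rfl
  have hintg : ∀ w ∈ g.rootSet (AlgebraicClosure ℚ), IsIntegral ℤ w := fun w hw ↦ by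
    have hmz : (X ^ 3 + C p * X ^ 2 + C q * X + C r : ℤ[X]).Monic := by
      have : (X ^ 3 + C p * X ^ 2 + C q * X + C r : ℤ[X]) = Cubic.toPoly ⟨1, p, q, r⟩ := by
        simp only [Cubic.toPoly, map_one, one_mul]
      rw [this]; exact Cubic.monic_of_a_eq_one'
    refine ⟨X ^ 3 + C p * X ^ 2 + C q * X + C r, hmz, ?_⟩
    have hw' := (mem_rootSet.mp hw).2
    simp only [hg, map_add, map_mul, map_pow, aeval_X, map_intCast] at hw'
    rw [← aeval_def]
    simp only [map_add, map_mul, map_pow, aeval_X, aeval_C]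
    simp only [eq_intCast]
    exact hw'
  have hβK : β ∈ K := by rw [hKdef]; exact IntermediateField.mem_adjoin_simple_self ℚ β
  set bK : 𝓞 ↥K := ⟨⟨β, hβK⟩, isIntegral_mk hβK (hintg β hβroot)⟩ with hbK
  set E₂ : 𝓞 ↥K2 := ⟨⟨e₂, hsubK2 he₂⟩, isIntegral_mk (hsubK2 he₂) (hintg e₂ he₂)⟩ with hE₂
  set E₃ : 𝓞 ↥K2 := ⟨⟨e₃, hsubK2 he₃⟩, isIntegral_mk (hsubK2 he₃) (hintg e₃ he₃)⟩ with hE₃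
  set xg : 𝓞 ↥K2 := E₂ - E₃ with hxg
  set m : 𝓞 ↥K := (p : 𝓞 ↥K) * (p : 𝓞 ↥K) - ((q : 𝓞 ↥K) + q + q + q) - ((p : 𝓞 ↥K) * bK + (p : 𝓞 ↥K) * bK)
    - (bK * bK + bK * bK + bK * bK) with hm
  have hxg_val : (((xg : 𝓞 ↥K2) : ↥K2) : AlgebraicClosure ℚ) = e₂ - e₃ := by
    rw [hxg, hE₂, hE₃]; push_cast; rfl
  have hm_val : (((m : 𝓞 ↥K) : ↥K) : AlgebraicClosure ℚ) =
      (p : AlgebraicClosure ℚ) * p - ((q : AlgebraicClosure ℚ) + q + q + q) - ((p : AlgebraicClosure ℚ) * β + p * β)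
        - (β * β + β * β + β * β) := by
    have eb : (((bK : 𝓞 ↥K) : ↥K) : AlgebraicClosure ℚ) = β := by rw [hbK]; rfl
    have ep : ((((p : 𝓞 ↥K)) : ↥K) : AlgebraicClosure ℚ) = p := rfl
    have eq' : ((((q : 𝓞 ↥K)) : ↥K) : AlgebraicClosure ℚ) = q := rfl
    rw [hm]; push_cast; rw [eb, ep, eq']
  have hvieta : (e₂ - e₃) ^ 2 = (p : AlgebraicClosure ℚ) * p - ((q : AlgebraicClosure ℚ) + q + q + q)
      - ((p : AlgebraicClosure ℚ) * β + p * β) - (β * β + β * β + β * β) := by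
    linear_combination sq_sub_eq_of_vieta hsum hprod
  have hm0 : m ≠ 0 := by
    intro h0
    have h1 : (e₂ - e₃) ^ 2 = 0 := by
      rw [hvieta, ← hm_val, h0]; simp
    exact hne23 (sub_eq_zero.mp (pow_eq_zero_iff two_ne_zero |>.mp h1))
  have hx : xg ^ 2 = algebraMap (𝓞 ↥K) (𝓞 ↥K2) m := by
    apply RingOfIntegers.ext
    apply Subtype.ext
    change (((xg ^ 2 : 𝓞 ↥K2) : ↥K2) : AlgebraicClosure ℚ) = (((m : 𝓞 ↥K) : ↥K) : AlgebraicClosure ℚ)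
    have e1 : (((xg ^ 2 : 𝓞 ↥K2) : ↥K2) : AlgebraicClosure ℚ) = ((((xg : 𝓞 ↥K2)) : ↥K2) : AlgebraicClosure ℚ) ^ 2 := by
      push_cast; rfl
    rw [e1, hxg_val, hm_val]
    exact hvieta
  -- §E `K2 = K(e₂ - e₃)`
  have hgen : Algebra.adjoin ↥K {((xg : 𝓞 ↥K2) : ↥K2)} = ⊤ := by
    set T : Subalgebra ↥K ↥K2 := Algebra.adjoin ↥K {((xg : 𝓞 ↥K2) : ↥K2)} with hT
    let S : Subalgebra ℚ (AlgebraicClosure ℚ) :=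
      { carrier := {w | ∃ hw : w ∈ K2, (⟨w, hw⟩ : ↥K2) ∈ T}
        mul_mem' := by
          rintro a b ⟨ha, ha'⟩ ⟨hb, hb'⟩
          exact ⟨mul_mem ha hb, by
            have e : (⟨a * b, mul_mem ha hb⟩ : ↥K2) = ⟨a, ha⟩ * ⟨b, hb⟩ := rfl
            rw [e]; exact T.mul_mem ha' hb'⟩
        one_mem' := ⟨one_mem _, by
          have e : (⟨1, one_mem _⟩ : ↥K2) = 1 := rfl
          rw [e]; exact T.one_mem⟩
        add_mem' := by
          rintro a b ⟨ha, ha'⟩ ⟨hb, hb'⟩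
          exact ⟨add_mem ha hb, by
            have e : (⟨a + b, add_mem ha hb⟩ : ↥K2) = ⟨a, ha⟩ + ⟨b, hb⟩ := rfl
            rw [e]; exact T.add_mem ha' hb'⟩
        zero_mem' := ⟨zero_mem _, by
          have e : (⟨0, zero_mem _⟩ : ↥K2) = 0 := rfl
          rw [e]; exact T.zero_mem⟩
        algebraMap_mem' := fun t ↦ ⟨IntermediateField.algebraMap_mem K2 t, T.algebraMap_mem (algebraMap ℚ ↥K t)⟩ }
    have hKS : ∀ w (hw : w ∈ K), w ∈ S := fun w hw ↦ ⟨hle hw, by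
      have e : (⟨w, hle hw⟩ : ↥K2) = algebraMap ↥K ↥K2 ⟨w, hw⟩ := rfl
      rw [e]; exact T.algebraMap_mem _⟩
    have hxS : e₂ - e₃ ∈ S := by
      refine ⟨sub_mem (hsubK2 he₂) (hsubK2 he₃), ?_⟩
      have e : (⟨e₂ - e₃, sub_mem (hsubK2 he₂) (hsubK2 he₃)⟩ : ↥K2) = ((xg : 𝓞 ↥K2) : ↥K2) :=
        Subtype.ext (by rw [hxg_val])
      rw [e]; exact Algebra.subset_adjoin (Set.mem_singleton _)
    have hβS : β ∈ S := hKS β hβK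
    have hpS : (p : AlgebraicClosure ℚ) ∈ S := by
      have h := S.algebraMap_mem (p : ℚ)
      rwa [map_intCast] at h
    have he₂S : e₂ ∈ S := by
      have e : e₂ = algebraMap ℚ (AlgebraicClosure ℚ) (1 / 2 : ℚ) * ((e₂ - e₃) + (-(p : AlgebraicClosure ℚ) - β)) := by
        rw [map_div₀, map_one, map_ofNat]
        linear_combination (1 / 2 : AlgebraicClosure ℚ) * hsum
      rw [e]
      exact S.mul_mem (S.algebraMap_mem _) (S.add_mem hxS (S.sub_mem (S.neg_mem hpS) hβS))
    have he₃S : e₃ ∈ S := by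
      have e : e₃ = e₂ - (e₂ - e₃) := by ring
      rw [e]
      exact S.sub_mem he₂S hxS
    have hrootS : g.rootSet (AlgebraicClosure ℚ) ⊆ S := fun w hw ↦ by
      rcases hall w hw with rfl | rfl | rfl
      exacts [hβS, he₂S, he₃S]
    have hK2S : K2.toSubalgebra ≤ S := by
      have e := IntermediateField.adjoin_toSubalgebra_of_isAlgebraic (F := ℚ) (E := AlgebraicClosure ℚ)
        (S := g.rootSet (AlgebraicClosure ℚ)) (fun w _ ↦ (AlgebraicClosure.isAlgebraic ℚ).isAlgebraic w)
      rw [hK2eq, e]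
      exact Algebra.adjoin_le hrootS
    rw [eq_top_iff]
    rintro ⟨w, hw⟩ -
    obtain ⟨hw', h⟩ := hK2S hw
    exact h
  -- §F μ₂ ascent along `ℚ(E[2])/ℚ(β)` and the totally-complex door
  have hμ2 := classicalMu_of_sq_eq_of_odd_finrank κ hκ ↥K ↥K2 hodd hm0 hx hgen hμ
  exact conjA_two_of_classicalMu_divisionField_two_of_Δ_neg W hΔ hμ2 κ hκ

end Summit.BirchSwinnertonDyer.BirchSwinnertonDyer.Theorems.SteinbergFibreAtTwo.TotallyComplexMu

end
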